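import Summits.Ventures.Crystal3D.Theorems.StickyWulffConstantNoReconstructionGainFourFamilyLocal
import HarnessLib

/-!
# Four-family Barlow films: the 36 unit vectors of `(1/3)Λ₀` (direction lemma)

HONEST FRAMING. Part of the venture `Summits/Ventures/Crystal3D` (cell `crystal3d-full`), helper
`--supports` the crux `NoReconstructionGain` (stmt-Ventures-19144, route
`route-Ventures-StickyWulffConstant`), line `adhesion`; continuation of `…FourFamilyLocal` (class (ii)).

The Barlow positions of all four `{111}` families of `Λ₀ = fccStacking 1 √(2/3)` lie in the refined
lattice `(1/3)Λ₀ = {(1/3) • pos K I J}`.  Its unit vectors are EXACTLY 36: the norm form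
`9‖(1/3) pos(K,I,J)‖² · 12 = 3(2I+J+K)² + (3J+K)² + 8K²` equals `108` only for the 12 kissing labels
`3·(unit label)` and the 24 twin labels — a bounded Diophantine check (`|K| ≤ 3`, `|J| ≤ 4`,
`|I| ≤ 6`).  Consequently the partner directions of ANY two balls of a film in `(1/3)Λ₀` lie in the list
`A18 ++ (−A18)` of the chamber certificate, with no coset bookkeeping at all (the 18 "bad" cosets of
`(1/3)Λ₀ / Λ₀` carry no unit vector).

* `third_unit_labels` — the Diophantine classification;
* `third_three`, `third_neg_three` — `(1/3) pos(3l) = pos l`, `(1/3) pos(−3l) = −pos l`;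
* `third_unit_mem` — a unit vector `(1/3) • pos K I J` is one of the 36 listed vectors (first the 18
  cost-2 directions of `fourFamilyChamber_cliques`, flattened, then the 18 of
  `fourFamilyChamber_plugExclusion`).

WHAT THIS IS NOT: the assembly (next file); F-C1 not moved.
-/

noncomputable section

namespace Summit.Ventures.Crystal3D.Theorems

open Summit.Ventures.Crystal3D Finset
open Literature.MathematicalPhysics.StatisticalMechanics (barlowPos barlowOffset layerNormal constHagg
  haggLabel_const barlowPos_apply_zero barlowPos_apply_one barlowPos_apply_two)
open scoped InnerProductSpace

/-- **Unit vectors of `(1/3)Λ₀`: the 36 labels.** -/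
theorem third_unit_labels (K I J : ℤ) (h : ‖(1 / 3 : ℝ) • barlowPos 1 (Real.sqrt (2 / 3)) constHagg K I J‖ = 1) :
    (K, I, J) ∈ ([(0, 3, (-3)), ((-1), 2, (-3)), ((-2), 3, (-2)), ((-3), 0, 0), ((-2), 1, (-2)), ((-3), 2, (-1)), (0, (-3), 0), ((-1), (-3), 2), ((-2), (-2), 1), ((-3), 0, 3), ((-2), (-2), 3), ((-3), (-1), 2), (0, 0, (-3)), (2, (-1), (-3)), (1, (-2), (-2)), ((-3), 3, 0), ((-2), 3, 1), ((-3), 2, 2), (0, (-3), 3), (3, 0, 0), (0, 3, 0), (3, 0, (-3)), (0, 0, 3), (3, (-3), 0), (3, (-2), 1), (2, (-1), 2), (2, (-3), 2), (1, (-2), 3), (3, 1, (-2)), (2, 2, (-1)), (2, 2, (-3)), (1, 3, (-2)), (3, (-2), (-2)), (2, (-3), (-1)), ((-1), 2, 2), ((-2), 1, 3)] : List (ℤ × ℤ × ℤ)) := by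
  have hsq : ‖(1 / 3 : ℝ) • barlowPos 1 (Real.sqrt (2 / 3)) constHagg K I J‖ ^ 2 = 1 := by rw [h, one_pow]
  rw [norm_smul, mul_pow, barlowPos_normSq, show ‖(1 / 3 : ℝ)‖ = 1 / 3 by norm_num] at hsq
  have hR : (3 * (2 * I + J + K) ^ 2 + (3 * J + K) ^ 2 + 8 * K ^ 2 : ℝ) = 108 := by
    linear_combination 108 * hsq
  have hZ : 3 * (2 * I + J + K) ^ 2 + (3 * J + K) ^ 2 + 8 * K ^ 2 = 108 := by exact_mod_cast hR
  have hK : -3 ≤ K ∧ K ≤ 3 := by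
    constructor <;> nlinarith [sq_nonneg (2 * I + J + K), sq_nonneg (3 * J + K), sq_nonneg (K + 4), sq_nonneg (K - 4)]
  have hJK : -10 ≤ 3 * J + K ∧ 3 * J + K ≤ 10 := by
    constructor <;> nlinarith [sq_nonneg (2 * I + J + K), sq_nonneg K, sq_nonneg (3 * J + K + 11),
      sq_nonneg (3 * J + K - 11)]
  have hIJK : -6 ≤ 2 * I + J + K ∧ 2 * I + J + K ≤ 6 := by
    constructor <;> nlinarith [sq_nonneg (3 * J + K), sq_nonneg K, sq_nonneg (2 * I + J + K + 7),
      sq_nonneg (2 * I + J + K - 7)]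
  have hJ : -4 ≤ J ∧ J ≤ 4 := by omega
  have hI : -6 ≤ I ∧ I ≤ 6 := by omega
  obtain ⟨hK1, hK2⟩ := hK
  obtain ⟨hJ1, hJ2⟩ := hJ
  obtain ⟨hI1, hI2⟩ := hI
  interval_cases K <;> interval_cases J <;> interval_cases I <;> first | (exfalso; omega) | decide

/-- `(1/3) • pos (3k, 3i, 3j) = pos (k, i, j)`. -/
theorem third_three (K I J k i j : ℤ) (hk : K = 3 * k) (hi : I = 3 * i) (hj : J = 3 * j) :
    (1 / 3 : ℝ) • barlowPos 1 (Real.sqrt (2 / 3)) constHagg K I J = barlowPos 1 (Real.sqrt (2 / 3)) constHagg k i j := by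
  subst hk hi hj
  have := barlowPos_zlin 3 0 k i j 0 0 0
  simp only [Int.cast_ofNat, Int.cast_zero, zero_smul, add_zero, mul_zero] at this
  rw [← this, smul_smul]; norm_num

/-- `(1/3) • pos (−3k, −3i, −3j) = −pos (k, i, j)`. -/
theorem third_neg_three (K I J k i j : ℤ) (hk : K = -(3 * k)) (hi : I = -(3 * i)) (hj : J = -(3 * j)) :
    (1 / 3 : ℝ) • barlowPos 1 (Real.sqrt (2 / 3)) constHagg K I J = -barlowPos 1 (Real.sqrt (2 / 3)) constHagg k i j := by
  subst hk hi hj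
  have := barlowPos_zlin (-3) 0 k i j 0 0 0
  simp only [Int.cast_neg, Int.cast_ofNat, Int.cast_zero, zero_smul, add_zero, neg_mul, mul_zero,
    neg_smul] at this
  rw [← this, smul_neg, smul_smul]; norm_num

/-- **Direction lemma.**  A unit vector of `(1/3)Λ₀` is one of the 36 vectors of the chamber
certificate: one of the 18 cost-2 directions of `fourFamilyChamber_cliques` (flattened, same order) or
one of their 18 antipodes as listed in `fourFamilyChamber_plugExclusion`. -/
theorem third_unit_mem (K I J : ℤ) (h : ‖(1 / 3 : ℝ) • barlowPos 1 (Real.sqrt (2 / 3)) constHagg K I J‖ = 1) :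
    (1 / 3 : ℝ) • barlowPos 1 (Real.sqrt (2 / 3)) constHagg K I J ∈ ([barlowPos 1 (Real.sqrt (2 / 3)) constHagg 0 1 (-1),
      (1 / 3 : ℝ) • barlowPos 1 (Real.sqrt (2 / 3)) constHagg (-1) 2 (-3),
      (1 / 3 : ℝ) • barlowPos 1 (Real.sqrt (2 / 3)) constHagg (-2) 3 (-2),
      -barlowPos 1 (Real.sqrt (2 / 3)) constHagg 1 0 0,
      (1 / 3 : ℝ) • barlowPos 1 (Real.sqrt (2 / 3)) constHagg (-2) 1 (-2),
      (1 / 3 : ℝ) • barlowPos 1 (Real.sqrt (2 / 3)) constHagg (-3) 2 (-1),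
      -barlowPos 1 (Real.sqrt (2 / 3)) constHagg 0 1 0,
      (1 / 3 : ℝ) • barlowPos 1 (Real.sqrt (2 / 3)) constHagg (-1) (-3) 2,
      (1 / 3 : ℝ) • barlowPos 1 (Real.sqrt (2 / 3)) constHagg (-2) (-2) 1,
      barlowPos 1 (Real.sqrt (2 / 3)) constHagg (-1) 0 1,
      (1 / 3 : ℝ) • barlowPos 1 (Real.sqrt (2 / 3)) constHagg (-2) (-2) 3,
      (1 / 3 : ℝ) • barlowPos 1 (Real.sqrt (2 / 3)) constHagg (-3) (-1) 2,
      -barlowPos 1 (Real.sqrt (2 / 3)) constHagg 0 0 1,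
      (1 / 3 : ℝ) • barlowPos 1 (Real.sqrt (2 / 3)) constHagg 2 (-1) (-3),
      (1 / 3 : ℝ) • barlowPos 1 (Real.sqrt (2 / 3)) constHagg 1 (-2) (-2),
      barlowPos 1 (Real.sqrt (2 / 3)) constHagg (-1) 1 0,
      (1 / 3 : ℝ) • barlowPos 1 (Real.sqrt (2 / 3)) constHagg (-2) 3 1,
      (1 / 3 : ℝ) • barlowPos 1 (Real.sqrt (2 / 3)) constHagg (-3) 2 2] : List (EuclideanSpace ℝ (Fin 3))) ∨
    (1 / 3 : ℝ) • barlowPos 1 (Real.sqrt (2 / 3)) constHagg K I J ∈ ([-barlowPos 1 (Real.sqrt (2 / 3)) constHagg 0 1 (-1),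
      barlowPos 1 (Real.sqrt (2 / 3)) constHagg 1 0 0,
      barlowPos 1 (Real.sqrt (2 / 3)) constHagg 0 1 0,
      -barlowPos 1 (Real.sqrt (2 / 3)) constHagg (-1) 0 1,
      barlowPos 1 (Real.sqrt (2 / 3)) constHagg 0 0 1,
      -barlowPos 1 (Real.sqrt (2 / 3)) constHagg (-1) 1 0,
      (1 / 3 : ℝ) • barlowPos 1 (Real.sqrt (2 / 3)) constHagg 3 (-2) 1,
      (1 / 3 : ℝ) • barlowPos 1 (Real.sqrt (2 / 3)) constHagg 2 (-1) 2,
      (1 / 3 : ℝ) • barlowPos 1 (Real.sqrt (2 / 3)) constHagg 2 (-3) 2,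
      (1 / 3 : ℝ) • barlowPos 1 (Real.sqrt (2 / 3)) constHagg 1 (-2) 3,
      (1 / 3 : ℝ) • barlowPos 1 (Real.sqrt (2 / 3)) constHagg 3 1 (-2),
      (1 / 3 : ℝ) • barlowPos 1 (Real.sqrt (2 / 3)) constHagg 2 2 (-1),
      (1 / 3 : ℝ) • barlowPos 1 (Real.sqrt (2 / 3)) constHagg 2 2 (-3),
      (1 / 3 : ℝ) • barlowPos 1 (Real.sqrt (2 / 3)) constHagg 1 3 (-2),
      (1 / 3 : ℝ) • barlowPos 1 (Real.sqrt (2 / 3)) constHagg 3 (-2) (-2),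
      (1 / 3 : ℝ) • barlowPos 1 (Real.sqrt (2 / 3)) constHagg 2 (-3) (-1),
      (1 / 3 : ℝ) • barlowPos 1 (Real.sqrt (2 / 3)) constHagg (-1) 2 2,
      (1 / 3 : ℝ) • barlowPos 1 (Real.sqrt (2 / 3)) constHagg (-2) 1 3] : List (EuclideanSpace ℝ (Fin 3))) := by
  have hl := third_unit_labels K I J h
  rcases hl with _ | ⟨_, hl⟩
  · rw [third_three 0 3 (-3) 0 1 (-1) (by norm_num) (by norm_num) (by norm_num)]
    exact Or.inl (List.Mem.head _)
  rcases hl with _ | ⟨_, hl⟩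
  · exact Or.inl (List.Mem.tail _ (List.Mem.head _))
  rcases hl with _ | ⟨_, hl⟩
  · exact Or.inl (List.Mem.tail _ (List.Mem.tail _ (List.Mem.head _)))
  rcases hl with _ | ⟨_, hl⟩
  · rw [third_neg_three (-3) 0 0 1 0 0 (by norm_num) (by norm_num) (by norm_num)]
    exact Or.inl (List.Mem.tail _ (List.Mem.tail _ (List.Mem.tail _ (List.Mem.head _))))
  rcases hl with _ | ⟨_, hl⟩
  · exact Or.inl (List.Mem.tail _ (List.Mem.tail _ (List.Mem.tail _ (List.Mem.tail _ (List.Mem.head _)))))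
  rcases hl with _ | ⟨_, hl⟩
  · exact Or.inl (List.Mem.tail _ (List.Mem.tail _ (List.Mem.tail _ (List.Mem.tail _ (List.Mem.tail _ (List.Mem.head _))))))
  rcases hl with _ | ⟨_, hl⟩
  · rw [third_neg_three 0 (-3) 0 0 1 0 (by norm_num) (by norm_num) (by norm_num)]
    exact Or.inl (List.Mem.tail _ (List.Mem.tail _ (List.Mem.tail _ (List.Mem.tail _ (List.Mem.tail _ (List.Mem.tail _ (List.Mem.head _)))))))
  rcases hl with _ | ⟨_, hl⟩
  · exact Or.inl (List.Mem.tail _ (List.Mem.tail _ (List.Mem.tail _ (List.Mem.tail _ (List.Mem.tail _ (List.Mem.tail _ (List.Mem.tail _ (List.Mem.head _))))))))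
  rcases hl with _ | ⟨_, hl⟩
  · exact Or.inl (List.Mem.tail _ (List.Mem.tail _ (List.Mem.tail _ (List.Mem.tail _ (List.Mem.tail _ (List.Mem.tail _ (List.Mem.tail _ (List.Mem.tail _ (List.Mem.head _)))))))))
  rcases hl with _ | ⟨_, hl⟩
  · rw [third_three (-3) 0 3 (-1) 0 1 (by norm_num) (by norm_num) (by norm_num)]
    exact Or.inl (List.Mem.tail _ (List.Mem.tail _ (List.Mem.tail _ (List.Mem.tail _ (List.Mem.tail _ (List.Mem.tail _ (List.Mem.tail _ (List.Mem.tail _ (List.Mem.tail _ (List.Mem.head _))))))))))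
  rcases hl with _ | ⟨_, hl⟩
  · exact Or.inl (List.Mem.tail _ (List.Mem.tail _ (List.Mem.tail _ (List.Mem.tail _ (List.Mem.tail _ (List.Mem.tail _ (List.Mem.tail _ (List.Mem.tail _ (List.Mem.tail _ (List.Mem.tail _ (List.Mem.head _)))))))))))
  rcases hl with _ | ⟨_, hl⟩
  · exact Or.inl (List.Mem.tail _ (List.Mem.tail _ (List.Mem.tail _ (List.Mem.tail _ (List.Mem.tail _ (List.Mem.tail _ (List.Mem.tail _ (List.Mem.tail _ (List.Mem.tail _ (List.Mem.tail _ (List.Mem.tail _ (List.Mem.head _))))))))))))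
  rcases hl with _ | ⟨_, hl⟩
  · rw [third_neg_three 0 0 (-3) 0 0 1 (by norm_num) (by norm_num) (by norm_num)]
    exact Or.inl (List.Mem.tail _ (List.Mem.tail _ (List.Mem.tail _ (List.Mem.tail _ (List.Mem.tail _ (List.Mem.tail _ (List.Mem.tail _ (List.Mem.tail _ (List.Mem.tail _ (List.Mem.tail _ (List.Mem.tail _ (List.Mem.tail _ (List.Mem.head _)))))))))))))
  rcases hl with _ | ⟨_, hl⟩
  · exact Or.inl (List.Mem.tail _ (List.Mem.tail _ (List.Mem.tail _ (List.Mem.tail _ (List.Mem.tail _ (List.Mem.tail _ (List.Mem.tail _ (List.Mem.tail _ (List.Mem.tail _ (List.Mem.tail _ (List.Mem.tail _ (List.Mem.tail _ (List.Mem.tail _ (List.Mem.head _))))))))))))))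
  rcases hl with _ | ⟨_, hl⟩
  · exact Or.inl (List.Mem.tail _ (List.Mem.tail _ (List.Mem.tail _ (List.Mem.tail _ (List.Mem.tail _ (List.Mem.tail _ (List.Mem.tail _ (List.Mem.tail _ (List.Mem.tail _ (List.Mem.tail _ (List.Mem.tail _ (List.Mem.tail _ (List.Mem.tail _ (List.Mem.tail _ (List.Mem.head _)))))))))))))))
  rcases hl with _ | ⟨_, hl⟩
  · rw [third_three (-3) 3 0 (-1) 1 0 (by norm_num) (by norm_num) (by norm_num)]
    exact Or.inl (List.Mem.tail _ (List.Mem.tail _ (List.Mem.tail _ (List.Mem.tail _ (List.Mem.tail _ (List.Mem.tail _ (List.Mem.tail _ (List.Mem.tail _ (List.Mem.tail _ (List.Mem.tail _ (List.Mem.tail _ (List.Mem.tail _ (List.Mem.tail _ (List.Mem.tail _ (List.Mem.tail _ (List.Mem.head _))))))))))))))))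
  rcases hl with _ | ⟨_, hl⟩
  · exact Or.inl (List.Mem.tail _ (List.Mem.tail _ (List.Mem.tail _ (List.Mem.tail _ (List.Mem.tail _ (List.Mem.tail _ (List.Mem.tail _ (List.Mem.tail _ (List.Mem.tail _ (List.Mem.tail _ (List.Mem.tail _ (List.Mem.tail _ (List.Mem.tail _ (List.Mem.tail _ (List.Mem.tail _ (List.Mem.tail _ (List.Mem.head _)))))))))))))))))
  rcases hl with _ | ⟨_, hl⟩
  · exact Or.inl (List.Mem.tail _ (List.Mem.tail _ (List.Mem.tail _ (List.Mem.tail _ (List.Mem.tail _ (List.Mem.tail _ (List.Mem.tail _ (List.Mem.tail _ (List.Mem.tail _ (List.Mem.tail _ (List.Mem.tail _ (List.Mem.tail _ (List.Mem.tail _ (List.Mem.tail _ (List.Mem.tail _ (List.Mem.tail _ (List.Mem.tail _ (List.Mem.head _))))))))))))))))))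
  rcases hl with _ | ⟨_, hl⟩
  · rw [third_neg_three 0 (-3) 3 0 1 (-1) (by norm_num) (by norm_num) (by norm_num)]
    exact Or.inr (List.Mem.head _)
  rcases hl with _ | ⟨_, hl⟩
  · rw [third_three 3 0 0 1 0 0 (by norm_num) (by norm_num) (by norm_num)]
    exact Or.inr (List.Mem.tail _ (List.Mem.head _))
  rcases hl with _ | ⟨_, hl⟩
  · rw [third_three 0 3 0 0 1 0 (by norm_num) (by norm_num) (by norm_num)]
    exact Or.inr (List.Mem.tail _ (List.Mem.tail _ (List.Mem.head _)))
  rcases hl with _ | ⟨_, hl⟩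
  · rw [third_neg_three 3 0 (-3) (-1) 0 1 (by norm_num) (by norm_num) (by norm_num)]
    exact Or.inr (List.Mem.tail _ (List.Mem.tail _ (List.Mem.tail _ (List.Mem.head _))))
  rcases hl with _ | ⟨_, hl⟩
  · rw [third_three 0 0 3 0 0 1 (by norm_num) (by norm_num) (by norm_num)]
    exact Or.inr (List.Mem.tail _ (List.Mem.tail _ (List.Mem.tail _ (List.Mem.tail _ (List.Mem.head _)))))
  rcases hl with _ | ⟨_, hl⟩
  · rw [third_neg_three 3 (-3) 0 (-1) 1 0 (by norm_num) (by norm_num) (by norm_num)]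
    exact Or.inr (List.Mem.tail _ (List.Mem.tail _ (List.Mem.tail _ (List.Mem.tail _ (List.Mem.tail _ (List.Mem.head _))))))
  rcases hl with _ | ⟨_, hl⟩
  · exact Or.inr (List.Mem.tail _ (List.Mem.tail _ (List.Mem.tail _ (List.Mem.tail _ (List.Mem.tail _ (List.Mem.tail _ (List.Mem.head _)))))))
  rcases hl with _ | ⟨_, hl⟩
  · exact Or.inr (List.Mem.tail _ (List.Mem.tail _ (List.Mem.tail _ (List.Mem.tail _ (List.Mem.tail _ (List.Mem.tail _ (List.Mem.tail _ (List.Mem.head _))))))))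
  rcases hl with _ | ⟨_, hl⟩
  · exact Or.inr (List.Mem.tail _ (List.Mem.tail _ (List.Mem.tail _ (List.Mem.tail _ (List.Mem.tail _ (List.Mem.tail _ (List.Mem.tail _ (List.Mem.tail _ (List.Mem.head _)))))))))
  rcases hl with _ | ⟨_, hl⟩
  · exact Or.inr (List.Mem.tail _ (List.Mem.tail _ (List.Mem.tail _ (List.Mem.tail _ (List.Mem.tail _ (List.Mem.tail _ (List.Mem.tail _ (List.Mem.tail _ (List.Mem.tail _ (List.Mem.head _))))))))))
  rcases hl with _ | ⟨_, hl⟩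
  · exact Or.inr (List.Mem.tail _ (List.Mem.tail _ (List.Mem.tail _ (List.Mem.tail _ (List.Mem.tail _ (List.Mem.tail _ (List.Mem.tail _ (List.Mem.tail _ (List.Mem.tail _ (List.Mem.tail _ (List.Mem.head _)))))))))))
  rcases hl with _ | ⟨_, hl⟩
  · exact Or.inr (List.Mem.tail _ (List.Mem.tail _ (List.Mem.tail _ (List.Mem.tail _ (List.Mem.tail _ (List.Mem.tail _ (List.Mem.tail _ (List.Mem.tail _ (List.Mem.tail _ (List.Mem.tail _ (List.Mem.tail _ (List.Mem.head _))))))))))))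
  rcases hl with _ | ⟨_, hl⟩
  · exact Or.inr (List.Mem.tail _ (List.Mem.tail _ (List.Mem.tail _ (List.Mem.tail _ (List.Mem.tail _ (List.Mem.tail _ (List.Mem.tail _ (List.Mem.tail _ (List.Mem.tail _ (List.Mem.tail _ (List.Mem.tail _ (List.Mem.tail _ (List.Mem.head _)))))))))))))
  rcases hl with _ | ⟨_, hl⟩
  · exact Or.inr (List.Mem.tail _ (List.Mem.tail _ (List.Mem.tail _ (List.Mem.tail _ (List.Mem.tail _ (List.Mem.tail _ (List.Mem.tail _ (List.Mem.tail _ (List.Mem.tail _ (List.Mem.tail _ (List.Mem.tail _ (List.Mem.tail _ (List.Mem.tail _ (List.Mem.head _))))))))))))))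
  rcases hl with _ | ⟨_, hl⟩
  · exact Or.inr (List.Mem.tail _ (List.Mem.tail _ (List.Mem.tail _ (List.Mem.tail _ (List.Mem.tail _ (List.Mem.tail _ (List.Mem.tail _ (List.Mem.tail _ (List.Mem.tail _ (List.Mem.tail _ (List.Mem.tail _ (List.Mem.tail _ (List.Mem.tail _ (List.Mem.tail _ (List.Mem.head _)))))))))))))))
  rcases hl with _ | ⟨_, hl⟩
  · exact Or.inr (List.Mem.tail _ (List.Mem.tail _ (List.Mem.tail _ (List.Mem.tail _ (List.Mem.tail _ (List.Mem.tail _ (List.Mem.tail _ (List.Mem.tail _ (List.Mem.tail _ (List.Mem.tail _ (List.Mem.tail _ (List.Mem.tail _ (List.Mem.tail _ (List.Mem.tail _ (List.Mem.tail _ (List.Mem.head _))))))))))))))))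
  rcases hl with _ | ⟨_, hl⟩
  · exact Or.inr (List.Mem.tail _ (List.Mem.tail _ (List.Mem.tail _ (List.Mem.tail _ (List.Mem.tail _ (List.Mem.tail _ (List.Mem.tail _ (List.Mem.tail _ (List.Mem.tail _ (List.Mem.tail _ (List.Mem.tail _ (List.Mem.tail _ (List.Mem.tail _ (List.Mem.tail _ (List.Mem.tail _ (List.Mem.tail _ (List.Mem.head _)))))))))))))))))
  rcases hl with _ | ⟨_, hl⟩
  · exact Or.inr (List.Mem.tail _ (List.Mem.tail _ (List.Mem.tail _ (List.Mem.tail _ (List.Mem.tail _ (List.Mem.tail _ (List.Mem.tail _ (List.Mem.tail _ (List.Mem.tail _ (List.Mem.tail _ (List.Mem.tail _ (List.Mem.tail _ (List.Mem.tail _ (List.Mem.tail _ (List.Mem.tail _ (List.Mem.tail _ (List.Mem.tail _ (List.Mem.head _))))))))))))))))))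
  exact absurd hl List.not_mem_nil

end Summit.Ventures.Crystal3D.Theorems

end
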